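import Summits.AtomisticToContinuum.Crystallization.Theorems.HolmgrenBoyleLindHalfSpaceUniqueContinuationThickNormalLines

/-!
# Route `HolmgrenBoyleLind`: Lennard-Jones force fields of separated sources, part 7 —
a point on a thick normal line is not a defect
Support file for the crux item stmt-AtomisticToContinuum-6075 (`HalfSpaceUniqueContinuation`, line
`registered`: infrastructure for its open stubs), sharpening part 6
(`hbl_eq_of_thick_normal_lines`, which asks a thick observer row below EVERY defect) to the local
form actually proved there:

* `hbl_iff_of_thick_normal_line` — two `δ`-separated sets in exact Lennard-Jones force balance
  agreeing on `{⟪z, u⟫ < a}`: a point `x₀` whose normal line `x₀ − ℝ u` carries a non-Blaschke row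
  of points of `ω` below the plane (`x₀ − tₙ u ∈ ω`, `tₙ ≥ ⟪x₀, u⟫ − a + 2` injective, `Σ 1/tₙ = ∞`)
  is NOT a defect: `x₀ ∈ ω ↔ x₀ ∈ ω'`. (Same proof: lowest defect `y₀` on the line, transverse
  Blaschke on the re-based row, clean segment up to `y₀`, `‖·‖⁻¹³` blow-up.)

Why the local form matters (layered core, `stub_layeredOpenVanishing`): in a stacking over a
horizontal lattice `L` the rows below a point are the layers whose registry class contains it; with
finitely many registries some class is thick (pigeonhole on `Σ 1/dₙ = ∞`), and for BARLOW-type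
stackings (one triangular coset per layer, registries `A, B, C`, consecutive layers distinct) at
least two of the three classes are thick while every defect layer exhibits two distinct classes —
so some defect lies on a thick column and the two stackings coincide. That corollary needs a
Lean carrier for Barlow stackings and is not stated here.
All `[folklore]`; nothing here closes an item.
-/

noncomputable section
namespace Summit.AtomisticToContinuum.Crystallization.Theorems.HolmgrenBoyleLind

open scoped BigOperators Topology InnerProductSpace
open Literature.MathematicalPhysics.StatisticalMechanics
open Summit.AtomisticToContinuum.Crystallization.Theorems

local notation "𝔼" => EuclideanSpace ℝ (Fin 3)

/-- **A point on a thick normal line is not a defect.** Let `ω, ω' ⊂ ℝ³` be `δ`-separated, both in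
exact Lennard-Jones force balance, agreeing on the open half-space `{⟪z, u⟫ < a}` (`u` a unit
vector). If the normal line through `x₀` carries points `x₀ − tₙ u ∈ ω` with
`tₙ ≥ ⟪x₀, u⟫ − a + 2` injective and `Σ 1/tₙ = ∞`, then `x₀ ∈ ω ↔ x₀ ∈ ω'`. Otherwise let `y₀` be
the lowest defect on that line (defects lie at levels `≥ a`, finitely many below `x₀` by
separation); the row re-based at `y₀` is still non-Blaschke, the difference field vanishes at its
points (`hbl_diffField_eq_zero_on_halfSpace`), hence on the open normal ray below the plane
(`hbl_inner_field_eq_zero_on_normal_ray`), hence along the clean segment up to `y₀`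
(`hbl_inner_field_eq_zero_on_line`) — contradicting the blow-up at the source `y₀`
(`hbl_field_ne_zero_near_source`). [folklore] -/
theorem hbl_iff_of_thick_normal_line :
    ∀ (ω ω' : Set (EuclideanSpace ℝ (Fin 3))) (δ : ℝ), 0 < δ →
      (∀ a ∈ ω, ∀ b ∈ ω, a ≠ b → δ ≤ dist a b) →
      (∀ a ∈ ω', ∀ b ∈ ω', a ≠ b → δ ≤ dist a b) →
      (∀ x ∈ ω, HasSum (fun y : {y : EuclideanSpace ℝ (Fin 3) // y ∈ ω ∧ y ≠ x} =>
        (deriv lennardJones (dist x y) / dist x y) • (x - (y : EuclideanSpace ℝ (Fin 3)))) 0) →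
      (∀ x ∈ ω', HasSum (fun y : {y : EuclideanSpace ℝ (Fin 3) // y ∈ ω' ∧ y ≠ x} =>
        (deriv lennardJones (dist x y) / dist x y) • (x - (y : EuclideanSpace ℝ (Fin 3)))) 0) →
      ∀ (u : EuclideanSpace ℝ (Fin 3)) (a : ℝ), ‖u‖ = 1 →
      (∀ z : EuclideanSpace ℝ (Fin 3), inner ℝ z u < a → (z ∈ ω ↔ z ∈ ω')) →
      ∀ (x₀ : EuclideanSpace ℝ (Fin 3)) (t₀ : ℕ → ℝ),
        (∀ n : ℕ, inner ℝ x₀ u - a + 2 ≤ t₀ n) → Function.Injective t₀ →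
        ¬ Summable (fun n : ℕ => (t₀ n)⁻¹) → (∀ n : ℕ, x₀ - t₀ n • u ∈ ω) →
      (x₀ ∈ ω ↔ x₀ ∈ ω') := by
  intro ω ω' δ hδ hsep hsep' hbal hbal' u a hu hagree x₀ t₀ ht₀ hinj₀ hsum₀ ht₀ω
  by_contra hx₀
  have hu0 : u ≠ 0 := norm_ne_zero_iff.1 (by rw [hu]; exact one_ne_zero)
  have hsepp : ∀ a ∈ ({y : 𝔼 | y ∈ ω ∧ y ∉ ω'} : Set 𝔼), ∀ b ∈ ({y : 𝔼 | y ∈ ω ∧ y ∉ ω'} : Set 𝔼),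
      a ≠ b → δ ≤ dist a b := fun a ha b hb hab => hsep a ha.1 b hb.1 hab
  have hsepm : ∀ a ∈ ({y : 𝔼 | y ∈ ω' ∧ y ∉ ω} : Set 𝔼), ∀ b ∈ ({y : 𝔼 | y ∈ ω' ∧ y ∉ ω} : Set 𝔼),
      a ≠ b → δ ≤ dist a b := fun a ha b hb hab => hsep' a ha.1 b hb.1 hab
  have hdef : ∀ z : 𝔼, ¬ (z ∈ ω ↔ z ∈ ω') ↔
      z ∈ ({y : 𝔼 | y ∈ ω ∧ y ∉ ω'} : Set 𝔼) ∪ {y : 𝔼 | y ∈ ω' ∧ y ∉ ω} := by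
    intro z
    simp only [Set.mem_union, Set.mem_setOf_eq]
    tauto
  have hlev : ∀ z : 𝔼, ¬ (z ∈ ω ↔ z ∈ ω') → a ≤ ⟪z, u⟫_ℝ := by
    intro z hz
    by_contra h
    push Not at h
    exact hz (hagree z h)
  -- the defects on the normal line through `x₀`, at or below `x₀`
  set D : Set ℝ := {σ : ℝ | 0 ≤ σ ∧ ¬ (x₀ - σ • u ∈ ω ↔ x₀ - σ • u ∈ ω')} with hD
  have hDfin : D.Finite := by
    have hfinj : Function.Injective (fun σ : ℝ => x₀ - σ • u) := fun σ τ h =>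
      smul_left_injective ℝ hu0 (sub_right_injective h)
    set b : ℝ := ⟪x₀, u⟫_ℝ - a with hb
    have h1 := (hbl_finite_near hδ hsep x₀ b).preimage hfinj.injOn
    have h2 := (hbl_finite_near hδ hsep' x₀ b).preimage hfinj.injOn
    refine (h1.union h2).subset ?_
    rintro σ ⟨hσ0, hσd⟩
    have hσb : σ ≤ b := by
      have h := hlev _ hσd
      rw [inner_sub_left, real_inner_smul_left, real_inner_self_eq_norm_sq, hu] at h
      rw [hb]
      linarith
    have hdist : dist (x₀ - σ • u) x₀ ≤ b := by
      rw [dist_eq_norm, sub_sub_cancel_left, norm_neg, norm_smul, Real.norm_eq_abs, hu, mul_one,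
        abs_of_nonneg hσ0]
      exact hσb
    by_cases hω : x₀ - σ • u ∈ ω
    · exact Or.inl ⟨hω, hdist⟩
    · have hω' : x₀ - σ • u ∈ ω' := by
        by_contra h'
        exact hσd ⟨fun h => (hω h).elim, fun h => (h' h).elim⟩
      exact Or.inr ⟨hω', hdist⟩
  have h0D : (0 : ℝ) ∈ D := ⟨le_rfl, by simpa using hx₀⟩
  obtain ⟨σs, hσs, hmax⟩ := Set.exists_max_image D id hDfin ⟨0, h0D⟩
  -- the lowest defect `y₀` on the line; beyond it the line is clean
  set y₀ : 𝔼 := x₀ - σs • u with hy₀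
  have hy₀d : ¬ (y₀ ∈ ω ↔ y₀ ∈ ω') := hσs.2
  have hclean : ∀ τ : ℝ, σs < τ → (x₀ - τ • u ∈ ω ↔ x₀ - τ • u ∈ ω') := by
    intro τ hτ
    by_contra h
    exact (not_le.2 hτ) (hmax τ ⟨hσs.1.trans hτ.le, h⟩)
  -- the thick sequence at `y₀`, the base point `p` and the direction `v = -u`
  -- the thick row at `x₀`, re-based at the lowest defect `y₀ = x₀ - σs • u` of its normal line
  obtain ⟨t, ht, hinj, hsum, htω⟩ : ∃ t : ℕ → ℝ, (∀ n, ⟪y₀, u⟫_ℝ - a + 2 ≤ t n) ∧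
      Function.Injective t ∧ ¬ Summable (fun n => (t n)⁻¹) ∧ ∀ n, y₀ - t n • u ∈ ω := by
    have hyu : ⟪y₀, u⟫_ℝ = ⟪x₀, u⟫_ℝ - σs := by
      rw [hy₀, inner_sub_left, real_inner_smul_left, real_inner_self_eq_norm_sq, hu]
      ring
    have hax₀ : a ≤ ⟪x₀, u⟫_ℝ := hlev x₀ hx₀
    have hay₀ : a ≤ ⟪y₀, u⟫_ℝ := hlev y₀ hy₀d
    have hpos : ∀ n, 0 < t₀ n - σs := fun n => by linarith [ht₀ n]
    refine ⟨fun n => t₀ n - σs, fun n => ?_, fun m n h => hinj₀ ?_, fun h => hsum₀ ?_, fun n => ?_⟩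
    · rw [hyu]
      linarith [ht₀ n]
    · simpa using h
    · refine Summable.of_nonneg_of_le (fun n => inv_nonneg.2 ?_) (fun n => ?_) h
      · linarith [hpos n, hσs.1]
      · exact (inv_le_inv₀ (by linarith [hpos n, hσs.1]) (hpos n)).2 (by linarith [hσs.1])
    · have e : y₀ - (t₀ n - σs) • u = x₀ - t₀ n • u := by
        rw [hy₀, sub_smul]
        abel
      rw [e]
      exact ht₀ω n
  set c : ℝ := ⟪y₀, u⟫_ℝ - a with hc
  have hc0 : 0 ≤ c := by
    have h := hlev y₀ hy₀d
    rw [hc]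
    linarith
  set p : 𝔼 := y₀ - (c + 1) • u with hp
  set v : 𝔼 := -u with hv
  have hvn : ‖v‖ = 1 := by rw [hv, norm_neg, hu]
  have hv0 : v ≠ 0 := norm_ne_zero_iff.1 (by rw [hvn]; exact one_ne_zero)
  have hpu : ⟪p, u⟫_ℝ = a - 1 := by
    rw [hp, inner_sub_left, real_inner_smul_left, real_inner_self_eq_norm_sq, hu, hc]
    ring
  have hmargin : ∀ y : 𝔼, ¬ (y ∈ ω ↔ y ∈ ω') → (1 : ℝ) ≤ ⟪p - y, v⟫_ℝ := by
    intro y hy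
    have h1 : ⟪p - y, v⟫_ℝ = ⟪y, u⟫_ℝ - ⟪p, u⟫_ℝ := by
      rw [hv, inner_neg_right, inner_sub_left]
      ring
    rw [h1, hpu]
    linarith [hlev y hy]
  have hclp : ∀ y ∈ ({y : 𝔼 | y ∈ ω ∧ y ∉ ω'} : Set 𝔼), (1 : ℝ) ≤ ⟪p - y, v⟫_ℝ :=
    fun y hy => hmargin y ((hdef y).2 (Or.inl hy))
  have hclm : ∀ y ∈ ({y : 𝔼 | y ∈ ω' ∧ y ∉ ω} : Set 𝔼), (1 : ℝ) ≤ ⟪p - y, v⟫_ℝ :=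
    fun y hy => hmargin y ((hdef y).2 (Or.inr hy))
  have hline : ∀ s : ℝ, p + s • v = x₀ - (σs + (c + 1) + s) • u := by
    intro s
    simp only [hp, hv, hy₀, smul_neg, add_smul]
    abel
  -- the zeros of `Φ` on the ray: `s_n = t_n - c - 1 ≥ 1`
  set s' : ℕ → ℝ := fun n => t n - (c + 1) with hs'
  have hs'1 : ∀ n, 1 ≤ s' n := fun n => by
    simp only [hs']
    linarith [ht n]
  have hs'inj : Function.Injective s' := by
    intro m n h
    apply hinj
    simp only [hs'] at h
    linarith
  have hs'sum : ¬ Summable (fun n => (s' n)⁻¹) := by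
    intro h
    refine hsum (Summable.of_nonneg_of_le (fun n => ?_) (fun n => ?_) h)
    · exact inv_nonneg.2 (by linarith [ht n, hc0])
    · refine (inv_le_inv₀ (by linarith [ht n, hc0]) (by linarith [hs'1 n])).2 ?_
      simp only [hs']
      linarith
  have hobs : ∀ n, p + s' n • v = y₀ - t n • u := by
    intro n
    simp only [hp, hv, hs', smul_neg, sub_smul, add_smul]
    abel
  have hΦ0 : ∀ n,
      (∑' y : ({y : 𝔼 | y ∈ ω ∧ y ∉ ω'} : Set 𝔼),
          (deriv lennardJones (dist (p + s' n • v) y) / dist (p + s' n • v) y) •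
            (p + s' n • v - (y : 𝔼))) -
        (∑' y : ({y : 𝔼 | y ∈ ω' ∧ y ∉ ω} : Set 𝔼),
          (deriv lennardJones (dist (p + s' n • v) y) / dist (p + s' n • v) y) •
            (p + s' n • v - (y : 𝔼))) = 0 := by
    intro n
    rw [hobs n]
    have hin : ⟪y₀ - t n • u, u⟫_ℝ < a := by
      rw [inner_sub_left, real_inner_smul_left, real_inner_self_eq_norm_sq, hu]
      have h := ht n
      rw [hc] at h
      linarith
    exact hbl_diffField_eq_zero_on_halfSpace hδ hsep hsep' hbal hbal' hagree _ (htω n) hin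
  -- Blaschke along the ray: `Φ = 0` on the open ray `σ > 0`
  have hray : ∀ (e : 𝔼) (σ : ℝ), 0 < σ →
      ⟪e, (∑' y : ({y : 𝔼 | y ∈ ω ∧ y ∉ ω'} : Set 𝔼),
          (deriv lennardJones (dist (p + σ • v) y) / dist (p + σ • v) y) •
            (p + σ • v - (y : 𝔼))) -
        (∑' y : ({y : 𝔼 | y ∈ ω' ∧ y ∉ ω} : Set 𝔼),
          (deriv lennardJones (dist (p + σ • v) y) / dist (p + σ • v) y) •
            (p + σ • v - (y : 𝔼)))⟫_ℝ = 0 := by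
    intro e
    exact hbl_inner_field_eq_zero_on_normal_ray _ _ _ _ hδ one_pos hsepp hsepm p v e hvn hclp hclm _ hs'1
      hs'inj hs'sum (fun n => by rw [hΦ0 n, inner_zero_right])
  -- blow-up near the source `y₀`
  have hy₀mem : y₀ ∈ ({y : 𝔼 | y ∈ ω ∧ y ∉ ω'} : Set 𝔼) ∪ {y : 𝔼 | y ∈ ω' ∧ y ∉ ω} :=
    (hdef y₀).1 hy₀d
  obtain ⟨ε, hε, hne0⟩ : ∃ ε : ℝ, 0 < ε ∧ ∀ x : 𝔼, dist x y₀ < ε → x ≠ y₀ →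
      (∑' y : ({y : 𝔼 | y ∈ ω ∧ y ∉ ω'} : Set 𝔼),
          (deriv lennardJones (dist x y) / dist x y) • (x - (y : 𝔼))) -
        (∑' y : ({y : 𝔼 | y ∈ ω' ∧ y ∉ ω} : Set 𝔼),
          (deriv lennardJones (dist x y) / dist x y) • (x - (y : 𝔼))) ≠ 0 := by
    rcases hy₀mem with hyp | hym
    · exact hbl_field_ne_zero_near_source hδ hsepp hsepm (fun y hy hy' => hy.2 hy'.1) hyp
    · obtain ⟨ε, hε, h⟩ :=
        hbl_field_ne_zero_near_source hδ hsepm hsepp (fun y hy hy' => hy.2 hy'.1) hym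
      refine ⟨ε, hε, fun x hx hxy h0 => h x hx hxy ?_⟩
      rw [← neg_sub, h0, neg_zero]
  -- the test point `x₁ = p + σ₁ v` at distance `ε₁` below `y₀` on the line
  set ε₁ : ℝ := min ε 1 / 2 with hε₁
  have hε₁0 : 0 < ε₁ := by
    rw [hε₁]
    exact half_pos (lt_min hε one_pos)
  have hε₁ε : ε₁ < ε := by
    rw [hε₁]
    linarith [min_le_left ε 1]
  have hε₁1 : ε₁ < 1 := by
    rw [hε₁]
    linarith [min_le_right ε 1]
  set σ₁ : ℝ := -(c + 1) + ε₁ with hσ₁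
  have hx₁ : p + σ₁ • v - y₀ = ε₁ • v := by
    simp only [hp, hv, hσ₁, smul_neg, add_smul, neg_smul]
    abel
  have hdist : dist (p + σ₁ • v) y₀ = ε₁ := by
    rw [dist_eq_norm, hx₁, norm_smul, hvn, mul_one, Real.norm_eq_abs, abs_of_pos hε₁0]
  have hne1 : p + σ₁ • v ≠ y₀ := by
    intro h
    rw [h, dist_self] at hdist
    exact hε₁0.ne hdist
  -- the segment `σ ∈ [σ₁ - ε₁/2, 2]` of the line is free of sources, hence uniformly clear
  have hsegclean : ∀ σ : ℝ, σ₁ - ε₁ / 2 ≤ σ →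
      p + σ • v ∉ ({y : 𝔼 | y ∈ ω ∧ y ∉ ω'} : Set 𝔼) ∪ {y : 𝔼 | y ∈ ω' ∧ y ∉ ω} := by
    intro σ hσ hmem
    have hd' := (hdef _).2 hmem
    rw [hline σ] at hd'
    have hτ : σs < σs + (c + 1) + σ := by
      rw [hσ₁] at hσ
      linarith
    exact hd' (hclean _ hτ)
  have hXc : IsClosed (({y : 𝔼 | y ∈ ω ∧ y ∉ ω'} : Set 𝔼) ∪ {y : 𝔼 | y ∈ ω' ∧ y ∉ ω}) :=
    (Metric.isClosed_of_pairwise_le_dist hδ hsepp).union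
      (Metric.isClosed_of_pairwise_le_dist hδ hsepm)
  obtain ⟨ρ, hρ, hclear⟩ : ∃ ρ : ℝ, 0 < ρ ∧ ∀ σ ∈ Set.Icc (σ₁ - ε₁ / 2) 2,
      ∀ y ∈ ({y : 𝔼 | y ∈ ω ∧ y ∉ ω'} : Set 𝔼) ∪ {y : 𝔼 | y ∈ ω' ∧ y ∉ ω},
        ρ ≤ ‖p + σ • v - y‖ := by
    have hγ : Continuous fun σ : ℝ => p + σ • v := by fun_prop
    have hcont : Continuous fun σ : ℝ => Metric.infDist (p + σ • v)
        (({y : 𝔼 | y ∈ ω ∧ y ∉ ω'} : Set 𝔼) ∪ {y : 𝔼 | y ∈ ω' ∧ y ∉ ω}) :=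
      (Metric.continuous_infDist_pt _).comp hγ
    have hpos : ∀ σ ∈ Set.Icc (σ₁ - ε₁ / 2) 2, 0 < Metric.infDist (p + σ • v)
        (({y : 𝔼 | y ∈ ω ∧ y ∉ ω'} : Set 𝔼) ∪ {y : 𝔼 | y ∈ ω' ∧ y ∉ ω}) :=
      fun σ hσ => (hXc.notMem_iff_infDist_pos ⟨y₀, hy₀mem⟩).1 (hsegclean σ hσ.1)
    obtain ⟨ρ, hρ, hle⟩ := isCompact_Icc.exists_forall_le' hcont.continuousOn hpos
    refine ⟨ρ, hρ, fun σ hσ y hy => (hle σ hσ).trans ?_⟩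
    rw [← dist_eq_norm]
    exact Metric.infDist_le_dist_of_mem hy
  -- identity theorem along the line, from the ray `σ > 0` down to `σ₁`
  have hcomp : ∀ e : 𝔼,
      ⟪e, (∑' y : ({y : 𝔼 | y ∈ ω ∧ y ∉ ω'} : Set 𝔼),
          (deriv lennardJones (dist (p + σ₁ • v) y) / dist (p + σ₁ • v) y) •
            (p + σ₁ • v - (y : 𝔼))) -
        (∑' y : ({y : 𝔼 | y ∈ ω' ∧ y ∉ ω} : Set 𝔼),
          (deriv lennardJones (dist (p + σ₁ • v) y) / dist (p + σ₁ • v) y) •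
            (p + σ₁ • v - (y : 𝔼)))⟫_ℝ = 0 := by
    intro e
    refine hbl_inner_field_eq_zero_on_line hδ hρ (half_pos hρ) hsepp hsepm p v e
      (a₁ := σ₁ - ε₁ / 2) (a₂ := 2)
      (fun y hy σ h1 h2 => hclear σ ⟨h1, h2⟩ y (Or.inl hy))
      (fun y hy σ h1 h2 => hclear σ ⟨h1, h2⟩ y (Or.inr hy))
      (by rw [hvn, mul_one]) (t₀ := 1) ⟨by linarith, by norm_num⟩ ?_ σ₁ ⟨by linarith, by linarith⟩
    filter_upwards [Ioi_mem_nhds (zero_lt_one' ℝ)] with σ hσ using hray e σ hσ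
  have hzero1 :
      (∑' y : ({y : 𝔼 | y ∈ ω ∧ y ∉ ω'} : Set 𝔼),
          (deriv lennardJones (dist (p + σ₁ • v) y) / dist (p + σ₁ • v) y) •
            (p + σ₁ • v - (y : 𝔼))) -
        (∑' y : ({y : 𝔼 | y ∈ ω' ∧ y ∉ ω} : Set 𝔼),
          (deriv lennardJones (dist (p + σ₁ • v) y) / dist (p + σ₁ • v) y) •
            (p + σ₁ • v - (y : 𝔼))) = 0 :=
    inner_self_eq_zero.1 (hcomp _)
  exact hne0 _ (by rw [hdist]; exact hε₁ε) hne1 hzero1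

/-- **Corollary: the global form.** If every defect has a thick normal row below the plane, the two
sets coincide (this re-derives `hbl_eq_of_thick_normal_lines` from the local form). [folklore] -/
theorem hbl_eq_of_thick_normal_lines' {ω ω' : Set 𝔼} {δ : ℝ} (hδ : 0 < δ)
    (hsep : ∀ a ∈ ω, ∀ b ∈ ω, a ≠ b → δ ≤ dist a b)
    (hsep' : ∀ a ∈ ω', ∀ b ∈ ω', a ≠ b → δ ≤ dist a b)
    (hbal : ∀ x ∈ ω, HasSum (fun y : {y : 𝔼 // y ∈ ω ∧ y ≠ x} =>
      (deriv lennardJones (dist x y) / dist x y) • (x - (y : 𝔼))) 0)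
    (hbal' : ∀ x ∈ ω', HasSum (fun y : {y : 𝔼 // y ∈ ω' ∧ y ≠ x} =>
      (deriv lennardJones (dist x y) / dist x y) • (x - (y : 𝔼))) 0)
    {u : 𝔼} {a : ℝ} (hu : ‖u‖ = 1)
    (hagree : ∀ z : 𝔼, ⟪z, u⟫_ℝ < a → (z ∈ ω ↔ z ∈ ω'))
    (hthick : ∀ x : 𝔼, ¬ (x ∈ ω ↔ x ∈ ω') → ∃ t : ℕ → ℝ,
      (∀ n, ⟪x, u⟫_ℝ - a + 2 ≤ t n) ∧ Function.Injective t ∧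
      ¬ Summable (fun n => (t n)⁻¹) ∧ ∀ n, x - t n • u ∈ ω) :
    ω = ω' := by
  ext x
  by_contra hx
  obtain ⟨t, ht, hinj, hsum, htω⟩ := hthick x hx
  exact hx (hbl_iff_of_thick_normal_line ω ω' δ hδ hsep hsep' hbal hbal' u a hu hagree x t ht hinj
    hsum htω)

end Summit.AtomisticToContinuum.Crystallization.Theorems.HolmgrenBoyleLind

end
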